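import Summits.ResolutionOfSingularities.ResolutionOfSingularities.Theorems.EquisingularLiftEquisingularLiftNatOneStepLineChart
import HarnessLib

/-!
# [OURS · L1 W4.5(b)] EL♮ FOR EVERY HYPERSURFACE WITH A ONE-STEP LINEAR SINGULAR LOCUS AT A COORDINATE `ℙʳ`, EVERY DIMENSION — T-ONESTEP-LINE:
# one blow-up along the coordinate `ℙʳ` resolves (crux `Theses.EquisingularLift.EquisingularLiftNat`, stmt-ResolutionOfSingularities-20038)

NOT a statement of any manuscript; OURS kernel theorem (cell `res-hironaka`, chain w45b; seat res-D-pv-013, own initiative, counted 0). AI-written,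
weaker than expert review. No definition, no `sorry`, standard axioms.

`F ∈ K[x₀,…,x_{m+2}]` a prime form, `e : Fin (r+1) → Fin (m+3)` injective the SURVIVING coordinates, `L = V(x_a : a ∉ range e) ≅ ℙʳ`. Hypotheses:
`F ∈ (x_a : a ∉ range e)` (`L ⊆ H`), some such `x_a ∉ (F)` (`H ⊄ L`), the charts `ChartRing F c`, `c ∉ range e`, are regular (`H ∖ L` regular), and for every
chart `c ∈ range e` a SPLITTING `ρ : K[y] ≃ R[z]` of the chart variables (cone variables onto the `z`'s, `R` a domain — e.g. `K[u]`) under which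
`F(x_c := 1) = Φ + Ψ` (`Φ ≠ 0` homogeneous of degree `μ` in `z`, `Ψ ∈ (z)^{μ+1}`) with explicit strict transforms `G_l` regular along the exceptional divisor
(`R[T]/(G_l)` regular at the primes containing `T̄_l`). Then `ELNatAt p K (m+2) (V₊(F)) ι`: ONE blow-up of `ℙ^{m+2}_{𝕎(K)}` along `ker Proj(f_O) ≅ ℙʳ_O`
(`elNatAt_of_linearCentreKill`, p535275); downstairs `HypersurfaceSpecimen.isRegularLocalRing_stalk_of_isBlowup_comap_of_mem_support` (p551698) with
`OneStepLine.isRegularLocalRing_localization_blowupAlgebra_chartRing` over the centre and the regular charts off it. The transversal type may DEGENERATE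
along `L` (pinch points — the Whitney umbrella `x₀x₁² − x₂²x₃`), which the linear-vertex cones (p540616) exclude.

* `OneStepLine.support_subset_range`, `not_range_subset_support` — the E1 clauses from `F ∈ (x_a : a ∉ range e)` and `x_a ∉ (F)`;
* **`OneStepLine.elNatAt_oneStepLine`** — the theorem.

References: Hartshorne II Prop. 5.9; The Stacks Project 0804, 02OS; Görtz–Wedhorn I 13.96 — through the cited tree files.
-/

set_option linter.dupNamespace false -- mandated namespace `Summit.<Summit>.<Problem>` of this single-conjunct summit

noncomputable section

open CategoryTheory CategoryTheory.Limits AlgebraicGeometry TopologicalSpace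
open MvPolynomial HomogeneousLocalization
open Literature.AlgebraicGeometry.Resolution
open Literature.AlgebraicGeometry.Motives Literature.AlgebraicGeometry.Motives.SmoothHypersurface
open Literature.AlgebraicGeometry.Motives.ProjectiveSpace
open AlgebraicGeometry.Scheme.IdealSheafData
open Summit.ResolutionOfSingularities.ResolutionOfSingularities.Cruxes.EquisingularLift.StrataSplit

namespace Summit.ResolutionOfSingularities.ResolutionOfSingularities.Cruxes.EquisingularLiftNat.Sections

namespace OneStepLine

attribute [local instance] MvPolynomial.gradedAlgebra ProjBaseChange.algebraBase

variable (k : Type) [Field k] {m : ℕ} (F : MvPolynomial (Fin (m + 2 + 1)) k) {d : ℕ} (hF : F.IsHomogeneous d)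
  {r : ℕ} (e : Fin (r + 1) → Fin (m + 2 + 1))
  (fk : homogeneousSubmodule (Fin (m + 2 + 1)) k →+*ᵍ homogeneousSubmodule (Fin (r + 1)) k)
  (hfk' : HomogeneousIdeal.irrelevant (homogeneousSubmodule (Fin (r + 1)) k) ≤
    (HomogeneousIdeal.irrelevant (homogeneousSubmodule (Fin (m + 2 + 1)) k)).map fk)
  (hfkC : ∀ a : k, fk (C a) = C a) (hfke : ∀ j : Fin (r + 1), fk (X (e j)) = X j)
  (hfk0 : ∀ i : Fin (m + 2 + 1), i ∉ Set.range e → fk (X i) = 0)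

include hfkC hfke hfk0 in
/-- **`V(Λ) ⊆ ι_H(H)`** when `F ∈ (x_a : a ∉ range e)`. [folklore] -/
theorem support_subset_range (hFmem : F ∈ Ideal.span ((fun a => (X a : MvPolynomial (Fin (m + 2 + 1)) k)) '' {a | a ∉ Set.range e})) :
    ((Proj.map fk hfk').ker.support : Set (Proj (homogeneousSubmodule (Fin (m + 2 + 1)) k))) ⊆ Set.range (hypersurfaceι F).left := by
  intro x hx
  refine (Set.ext_iff.mp (range_hypersurfaceι F) x).mpr ((ProjectiveSpectrum.mem_zeroLocus _ _ _).mpr (Set.singleton_subset_iff.mpr ?_))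
  change F ∈ x.asHomogeneousIdeal
  refine (Ideal.span_le.mpr ?_) hFmem
  rintro _ ⟨a, ha, rfl⟩
  exact LinearCentre.X_mem_asHomogeneousIdeal_of_mem_support e fk hfk' hfkC hfke hfk0 hx ha

include hF hfkC hfke hfk0 in
/-- **`ι_H(H) ⊄ V(Λ)`** when some killed `x_a ∉ (F)` (the generic point `(F)` of `H` misses `V₊(x_a)`). [folklore] -/
theorem not_range_subset_support (hFp : Prime F) {a : Fin (m + 2 + 1)} (ha : a ∉ Set.range e)
    (hXa : (X a : MvPolynomial (Fin (m + 2 + 1)) k) ∉ Ideal.span {F}) :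
    ¬ (Set.range (hypersurfaceι F).left ⊆ ((Proj.map fk hfk').ker.support : Set (Proj (homogeneousSubmodule (Fin (m + 2 + 1)) k)))) := by
  intro h
  have hmem : (pointOfPrime F hF hFp : Proj (homogeneousSubmodule (Fin (m + 2 + 1)) k)) ∈ Set.range (hypersurfaceι F).left := by
    refine (Set.ext_iff.mp (range_hypersurfaceι F) _).mpr ((ProjectiveSpectrum.mem_zeroLocus _ _ _).mpr (Set.singleton_subset_iff.mpr ?_))
    exact Ideal.subset_span rfl
  exact hXa (LinearCentre.X_mem_asHomogeneousIdeal_of_mem_support e fk hfk' hfkC hfke hfk0 (h hmem) ha)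

end OneStepLine

/-! ## EL♮ for hypersurfaces with a one-step linear singular locus -/

namespace OneStepLine

attribute [local instance] MvPolynomial.gradedAlgebra ProjBaseChange.algebraBase

/-- **EL♮ HOLDS FOR EVERY HYPERSURFACE WHOSE SINGULAR LOCUS IS A ONE-STEP COORDINATE `ℙʳ`, IN EVERY DIMENSION AND CHARACTERISTIC.** `K` algebraically
closed of characteristic `p`; `F ∈ K[x₀,…,x_{m+2}]` a prime form; `e` injective the surviving coordinates, `L = V(x_a : a ∉ range e)`; `F ∈ (x_a : a ∉ range e)`,
some such `x_a ∉ (F)`; the charts off `L` regular; and for every `c ∈ range e` splitting data `(R, ρ, Φ, Ψ, μ)` with one-step strict transforms (see the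
module docstring). Then `Theorems.EquisingularLift.ELNatAt p K (m+2) (V₊(F)) ι` by ONE blow-up along `ℙʳ_{𝕎(K)}` (`elNatAt_of_linearCentreKill`).
[OURS · L1 W4.5b] [folklore] -/
theorem elNatAt_oneStepLine (p : ℕ) (hp : p.Prime) (K : Type) [Field K] [CharP K p] [IsAlgClosed K] {m : ℕ}
    (F : MvPolynomial (Fin (m + 2 + 1)) K) {d : ℕ} (hF : F.IsHomogeneous d) (hFp : Prime F)
    {r : ℕ} (e : Fin (r + 1) → Fin (m + 2 + 1)) (he : Function.Injective e)
    (hFmem : F ∈ Ideal.span ((fun a => (X a : MvPolynomial (Fin (m + 2 + 1)) K)) '' {a | a ∉ Set.range e}))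
    (hXa : ∃ a, a ∉ Set.range e ∧ (X a : MvPolynomial (Fin (m + 2 + 1)) K) ∉ Ideal.span {F})
    (hoff : ∀ c, c ∉ Set.range e → IsRegularRing (ChartRing F c hF))
    (hone : ∀ c ∈ Set.range e, ∃ (M : ℕ) (R : Type) (_ : CommRing R) (_ : IsDomain R)
      (ρ : MvPolynomial (Fin (m + 2)) K ≃+* MvPolynomial (Fin (M + 1)) R),
      (∀ j : Fin (m + 2), c.succAbove j ∉ Set.range e → ∃ i : Fin (M + 1), ρ (X j) = X i) ∧
      (∀ i : Fin (M + 1), ∃ j : Fin (m + 2), c.succAbove j ∉ Set.range e ∧ ρ (X j) = X i) ∧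
      ∃ (Φ Ψ : MvPolynomial (Fin (M + 1)) R) (μ : ℕ), Φ.IsHomogeneous μ ∧ Φ ≠ 0 ∧
        Ψ ∈ Ideal.span (Set.range (X : Fin (M + 1) → MvPolynomial (Fin (M + 1)) R)) ^ (μ + 1) ∧
        ρ (dehomogenize K c F) = Φ + Ψ ∧ (Ideal.span {dehomogenize K c F}).radical = Ideal.span {dehomogenize K c F} ∧
        ∀ l : Fin (M + 1), ∃ G : MvPolynomial (Fin (M + 1)) R,
          aeval (fun j => X l * Function.update (X : Fin (M + 1) → MvPolynomial (Fin (M + 1)) R) l 1 j) (Φ + Ψ) = X l ^ μ * G ∧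
          ∀ (P : Ideal (MvPolynomial (Fin (M + 1)) R ⧸ Ideal.span {G})) [P.IsPrime],
            Ideal.Quotient.mk (Ideal.span {G}) (X l) ∈ P → IsRegularLocalRing (Localization.AtPrime P)) :
    Theorems.EquisingularLift.ELNatAt p K (m + 2) (hypersurface F).left (hypersurfaceι F).left := by
  classical
  have hd : 0 < d := ConeN.pos_of_prime_of_isHomogeneous K F hF hFp
  obtain ⟨fk, hfk', hfkC, hfke, hfk0⟩ := LinearCentre.exists_kill (R := K) e he
  haveI := HypersurfaceSpecimen.isIntegral_hypersurface_of_prime K F hF hFp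
  obtain ⟨a₀, ha₀, hXa₀⟩ := hXa
  refine elNatAt_of_linearCentreKill p hp K e he _ (hypersurfaceι F).left fk hfk' hfkC hfke hfk0
    (support_subset_range K F e fk hfk' hfkC hfke hfk0 hFmem)
    (not_range_subset_support K F hF e fk hfk' hfkC hfke hfk0 hFp ha₀ hXa₀) ?_
  -- every blow-up of `H` along `Λ·𝒪_H` is regular
  intro Z ρ hρ z
  by_cases hzs : ρ z ∈ ((((Proj.map fk hfk').ker).comap (hypersurfaceι F).left).support : Set (hypersurface F).left)
  · -- over the centre: the chart of a one-step linear centre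
    refine HypersurfaceSpecimen.isRegularLocalRing_stalk_of_isBlowup_comap_of_mem_support K F hF hd e he fk hfk' hfkC hfke hfk0
      (fun c hc a 𝔐 _ h𝔐 => ?_) hρ z hzs
    obtain ⟨M, R, _, _, ρ', hρ₁, hρ₂, Φ, Ψ, μ, hΦ, hΦ0, hΨ, hρf, hrad, hG⟩ := hone c hc
    exact isRegularLocalRing_localization_blowupAlgebra_chartRing K F hF c e R ρ' hρ₁ hρ₂ hc _ rfl hrad Φ Ψ hΦ hΦ0 hΨ hρf hG a 𝔐 h𝔐
  · -- off the centre: the blow-up is a local isomorphism onto a regular chart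
    haveI := hρ.isIso_stalkMap_of_not_mem_support hzs
    have hι : (hypersurfaceι F).left (ρ z) ∉ ((Proj.map fk hfk').ker.support : Set (Proj (homogeneousSubmodule (Fin (m + 2 + 1)) K))) := by
      intro h
      apply hzs
      rw [Scheme.IdealSheafData.support_comap]
      exact h
    obtain ⟨a, ha, hXa'⟩ := LinearCentre.exists_X_not_mem_of_not_mem_support e he fk hfk' hfkC hfke hfk0 hι
    haveI := OrdPoint.isRegularLocalRing_stalk_of_chartRing K F hF hd a (hoff a ha) (ρ z) ((Proj.mem_basicOpen _ _ _).mpr hXa')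
    exact IsRegularLocalRing.of_ringEquiv (R := (hypersurface F).left.presheaf.stalk (ρ z)) (asIso (ρ.stalkMap z)).commRingCatIsoToRingEquiv

end OneStepLine

end Summit.ResolutionOfSingularities.ResolutionOfSingularities.Cruxes.EquisingularLiftNat.Sections

end
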